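import Literature.NumberTheory.EllipticCurves.TateFormOfJ
import Literature.NumberTheory.EllipticCurves.ComplexMultiplicationHasCMProofs
import HarnessLib

/-!
# Curves with the same `j`-invariant: a `K̄`-isomorphism and its Galois cocycle of exponent `12`

Topic `NumberTheory/EllipticCurves`; theorems only (no definitions, no named facts).  J. H.
Silverman, *The Arithmetic of Elliptic Curves*, 2nd ed., Prop. III.1.4(b) (same `j` ⟹
isomorphic over `K̄`), Cor. III.10.2 (every automorphism has order dividing `24`; in
characteristic `0` the automorphism group is `μ₂`, `μ₄` or `μ₆`, Thm. III.10.1) and X.5.4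
(twists: `E'` is obtained from `E` by the cocycle `σ ↦ ι ∘ (ι^σ)⁻¹ ∈ Aut(E')`), in the
following concrete form, for two elliptic curves `E, E'` over a field `K` of characteristic `0`
with `j(E) = j(E')` (`exists_addEquiv_geomPoints_cocycle_of_j_eq`):

  there is an additive isomorphism `ι : E(K̄) ≃+ E'(K̄)`, algebraic in both directions, such that
  for every `σ ∈ Γ_K` there is an **algebraic** additive endomorphism `c = c_σ` of `E'(K̄)` with
  **`c¹² = 1`** and `ι(σ • P) = c(σ • ι(P))` for all `P`.

Construction: short normal forms `E₁ = C₁ • E : y² = x³ + Ax + B`, `E₂ = C₂ • E' : y² = x³ +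
A'x + B'` over `K`; a parameter `u ∈ K̄ˣ` with `u⁴A' = A`, `u⁶B' = B` and `u¹² ∈ K`
(`exists_twisting_parameter`: `u² = (B/B')/(A/A')` if `AB ≠ 0`, `u⁶ = B/B'` if `A = 0`,
`u⁴ = A/A'` if `B = 0`); the scaling `(x, y) ↦ (u⁻²x, u⁻³y)` carries `(E₁)_{K̄}` to `(E₂)_{K̄}`,
and `ι` is its composite with the `K`-rational substitutions.  For `σ ∈ Γ_K` the cocycle is the
scaling by `ζ = σ(u)/u` — an automorphism of `E₂` since `ζ⁴A' = A'`, `ζ⁶B' = B'`, of order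
dividing `12` since `ζ¹² = σ(u¹²)/u¹² = 1` — transported to `E'` along `C₂`.  Algebraicity of all
these maps is the tree's `isAlgebraicOn_pointEquiv_trans_congrEquiv{,_symm}` and
`IsAlgebraicOn.comp`.  Consumer: the transport of the Cartan-image clause of
`Literature.NumberTheory.EllipticCurves.cmTorsion_cartanImage` from a reference CM curve to all
its twists (`σ¹²` is intertwined by `ι` whenever `σ` commutes with `c_σ`).

## References

* [SilvermanAEC2009] J. H. Silverman, *The Arithmetic of Elliptic Curves*, 2nd ed., GTM 106
  (2009): Prop. III.1.4(b), III.1 Table 3.1, Thm. III.10.1, Cor. III.10.2, X.5.4.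
-/

noncomputable section

open scoped Classical

namespace Literature.NumberTheory.EllipticCurves

-- `_root_`: some import closures declare `Literature.NumberTheory.EllipticCurves.WeierstrassCurve.*`
open _root_.WeierstrassCurve

universe u

variable {K : Type u} [Field K]

/-! ### The twisting parameter between two short normal forms with the same `j` -/

/-- **The twisting parameter.**  For elliptic curves `E₁ : y² = x³ + Ax + B`,
`E₂ : y² = x³ + A'x + B'` in short normal form over `K` (characteristic `0`) with the same
`j`-invariant there is `u ∈ K̄`, `u ≠ 0`, with `u⁴A' = A`, `u⁶B' = B` and `u¹² ∈ K`: if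
`AB ≠ 0` take `u² = (B/B')/(A/A')` (Silverman, *AEC*, X.5.4, the quadratic twist; Mathlib's proof
of `exists_variableChange_of_j_eq`), if `A = 0` (`j = 0`) a sixth root of `B/B'`, if `B = 0`
(`j = 1728`) a fourth root of `A/A'` (*AEC* X.5.4, cases (ii), (iii)); the relation
`A³B'² = A'³B²` is the tree's `a₄_pow_mul_a₆_sq_eq_of_j_eq`.
[cite: SilvermanAEC2009, Prop. X.5.4 and Prop. III.1.4(b)] -/
theorem exists_twisting_parameter [CharZero K] {E₁ E₂ : WeierstrassCurve K} [E₁.IsElliptic]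
    [E₁.IsShortNF] [E₂.IsElliptic] [E₂.IsShortNF] (hj : E₁.j = E₂.j) :
    ∃ u : AlgebraicClosure K, u ≠ 0 ∧
      u ^ 4 * algebraMap K (AlgebraicClosure K) E₂.a₄ = algebraMap K (AlgebraicClosure K) E₁.a₄ ∧
      u ^ 6 * algebraMap K (AlgebraicClosure K) E₂.a₆ = algebraMap K (AlgebraicClosure K) E₁.a₆ ∧
      ∃ w : K, u ^ 12 = algebraMap K (AlgebraicClosure K) w := by
  set f := algebraMap K (AlgebraicClosure K) with hf
  have hrel := a₄_pow_mul_a₆_sq_eq_of_j_eq hj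
  have hΔ₁ := E₁.Δ'.ne_zero
  rw [coe_Δ', Δ_of_isShortNF] at hΔ₁
  have hΔ₂ := E₂.Δ'.ne_zero
  rw [coe_Δ', Δ_of_isShortNF] at hΔ₂
  by_cases hA : E₁.a₄ = 0
  · -- `j = 0`: sextic twists
    have hB : E₁.a₆ ≠ 0 := by
      intro h
      apply hΔ₁
      rw [hA, h]
      ring
    have hA' : E₂.a₄ = 0 := by
      have h0 : E₂.a₄ ^ 3 * E₁.a₆ ^ 2 = 0 := by rw [← hrel, hA]; ring
      rcases mul_eq_zero.mp h0 with h | h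
      · exact (pow_eq_zero_iff three_ne_zero).mp h
      · exact absurd ((pow_eq_zero_iff two_ne_zero).mp h) hB
    have hB' : E₂.a₆ ≠ 0 := by
      intro h
      apply hΔ₂
      rw [hA', h]
      ring
    have hfB : f E₁.a₆ ≠ 0 := (map_ne_zero f).mpr hB
    have hfB' : f E₂.a₆ ≠ 0 := (map_ne_zero f).mpr hB'
    obtain ⟨u, hu⟩ := IsAlgClosed.exists_pow_nat_eq (f E₁.a₆ / f E₂.a₆) (by norm_num : 0 < 6)
    have hu0 : u ≠ 0 := by
      rintro rfl
      rw [zero_pow (by norm_num), eq_comm, div_eq_zero_iff] at hu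
      rcases hu with h | h
      · exact hfB h
      · exact hfB' h
    refine ⟨u, hu0, ?_, ?_, (E₁.a₆ / E₂.a₆) ^ 2, ?_⟩
    · rw [hA, hA', map_zero, mul_zero]
    · rw [hu, div_mul_cancel₀ _ hfB']
    · rw [show u ^ 12 = (u ^ 6) ^ 2 by ring, hu, map_pow, map_div₀]
  · by_cases hB : E₁.a₆ = 0
    · -- `j = 1728`: quartic twists
      have hB' : E₂.a₆ = 0 := by
        have h0 : E₁.a₄ ^ 3 * E₂.a₆ ^ 2 = 0 := by rw [hrel, hB]; ring
        rcases mul_eq_zero.mp h0 with h | h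
        · exact absurd ((pow_eq_zero_iff three_ne_zero).mp h) hA
        · exact (pow_eq_zero_iff two_ne_zero).mp h
      have hA' : E₂.a₄ ≠ 0 := by
        intro h
        apply hΔ₂
        rw [hB', h]
        ring
      have hfA : f E₁.a₄ ≠ 0 := (map_ne_zero f).mpr hA
      have hfA' : f E₂.a₄ ≠ 0 := (map_ne_zero f).mpr hA'
      obtain ⟨u, hu⟩ := IsAlgClosed.exists_pow_nat_eq (f E₁.a₄ / f E₂.a₄) (by norm_num : 0 < 4)
      have hu0 : u ≠ 0 := by
        rintro rfl
        rw [zero_pow (by norm_num), eq_comm, div_eq_zero_iff] at hu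
        rcases hu with h | h
        · exact hfA h
        · exact hfA' h
      refine ⟨u, hu0, ?_, ?_, (E₁.a₄ / E₂.a₄) ^ 3, ?_⟩
      · rw [hu, div_mul_cancel₀ _ hfA']
      · rw [hB, hB', map_zero, mul_zero]
      · rw [show u ^ 12 = (u ^ 4) ^ 3 by ring, hu, map_pow, map_div₀]
    · -- `j ≠ 0, 1728`: quadratic twists
      have hA' : E₂.a₄ ≠ 0 := by
        intro h
        have h1 : E₁.a₄ ^ 3 * E₂.a₆ ^ 2 = 0 := by rw [hrel, h]; ring
        have hB' : E₂.a₆ = 0 := by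
          rcases mul_eq_zero.mp h1 with h' | h'
          · exact absurd ((pow_eq_zero_iff three_ne_zero).mp h') hA
          · exact (pow_eq_zero_iff two_ne_zero).mp h'
        apply hΔ₂
        rw [h, hB']
        ring
      have hB' : E₂.a₆ ≠ 0 := by
        intro h
        have h1 : E₂.a₄ ^ 3 * E₁.a₆ ^ 2 = 0 := by rw [← hrel, h]; ring
        rcases mul_eq_zero.mp h1 with h' | h'
        · exact hA' ((pow_eq_zero_iff three_ne_zero).mp h')
        · exact hB ((pow_eq_zero_iff two_ne_zero).mp h')
      set d : K := E₁.a₆ / E₂.a₆ / (E₁.a₄ / E₂.a₄) with hd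
      have hd0 : d ≠ 0 := div_ne_zero (div_ne_zero hB hB') (div_ne_zero hA hA')
      obtain ⟨u, hu⟩ := IsAlgClosed.exists_pow_nat_eq (f d) two_pos
      have hu0 : u ≠ 0 := by
        rintro rfl
        rw [zero_pow two_ne_zero, eq_comm, map_eq_zero] at hu
        exact hd0 hu
      have hfA : f E₁.a₄ ≠ 0 := (map_ne_zero f).mpr hA
      have hfA' : f E₂.a₄ ≠ 0 := (map_ne_zero f).mpr hA'
      have hfB' : f E₂.a₆ ≠ 0 := (map_ne_zero f).mpr hB'
      have hu4 : u ^ 4 = f E₁.a₄ / f E₂.a₄ := by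
        rw [pow_mul u 2 2, hu, hd]
        simp only [map_div₀]
        field_simp
        have := congrArg f hrel
        simp only [map_mul, map_pow] at this
        linear_combination -this
      have hu6 : u ^ 6 = f E₁.a₆ / f E₂.a₆ := by
        rw [show u ^ 6 = u ^ 4 * u ^ 2 by ring, hu4, hu, hd]
        simp only [map_div₀]
        field_simp
      refine ⟨u, hu0, ?_, ?_, d ^ 6, ?_⟩
      · rw [hu4, div_mul_cancel₀ _ hfA']
      · rw [hu6, div_mul_cancel₀ _ hfB']
      · rw [show u ^ 12 = (u ^ 2) ^ 6 by ring, hu, map_pow]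

/-! ### The scaling automorphism of a short Weierstrass equation -/

section Scaling

variable {L : Type u} [Field L]

/-- **The scaling `(x, y) ↦ (ζ²x, ζ³y)` is an automorphism of `y² = x³ + ax + b`** as soon as
`ζ⁴a = a` and `ζ⁶b = b` (Silverman, *AEC*, III.1 Table 3.1: the change of variables
`(ζ⁻¹, 0, 0, 0)` sends `(a₄, a₆)` to `(ζ⁴a₄, ζ⁶a₆)`; Thm. III.10.1 for the list of such `ζ`).
[cite: SilvermanAEC2009, III.1 Table 3.1 and Thm. III.10.1] -/
theorem scaling_smul_eq_self (V : WeierstrassCurve L) (h1 : V.a₁ = 0) (h2 : V.a₂ = 0)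
    (h3 : V.a₃ = 0) {ζ : L} (hζ : ζ ≠ 0) (h4 : ζ ^ 4 * V.a₄ = V.a₄) (h6 : ζ ^ 6 * V.a₆ = V.a₆) :
    (⟨(Units.mk0 ζ hζ)⁻¹, 0, 0, 0⟩ : VariableChange L) • V = V := by
  ext
  · simp [variableChange_a₁, h1]
  · simp [variableChange_a₂, h1, h2]
  · simp [variableChange_a₃, h3]
  · simp only [variableChange_a₄, h1, h2, h3, inv_inv, Units.val_mk0, mul_zero, sub_zero, add_zero]
    linear_combination h4
  · simp only [variableChange_a₆, h1, h2, h3, inv_inv, Units.val_mk0, mul_zero, sub_zero, add_zero]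
    linear_combination h6

end Scaling

/-- **The scaling automorphism on geometric points.**  Let `E₂ : y² = x³ + A'x + B'` be a short
Weierstrass equation over `K` and `ζ ∈ K̄ˣ` with `ζ⁴A' = A'`, `ζ⁶B' = B'`, `ζ¹² = 1`.  Then the
additive automorphism `A` of `E₂(K̄)` induced by the change of variables `(ζ⁻¹, 0, 0, 0)` is
algebraic, acts on affine points by `(x, y) ↦ (ζ²x, ζ³y)`, and satisfies `A¹² = 1` (Silverman,
*AEC*, Thm. III.10.1, Cor. III.10.2). [cite: SilvermanAEC2009, Thm. III.10.1 and Cor. III.10.2] -/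
theorem exists_scaling_geomPoints (E₂ : WeierstrassCurve K) (h1 : E₂.a₁ = 0) (h2 : E₂.a₂ = 0)
    (h3 : E₂.a₃ = 0) {ζ : AlgebraicClosure K} (hζ : ζ ≠ 0)
    (h4 : ζ ^ 4 * algebraMap K (AlgebraicClosure K) E₂.a₄ = algebraMap K (AlgebraicClosure K) E₂.a₄)
    (h6 : ζ ^ 6 * algebraMap K (AlgebraicClosure K) E₂.a₆ = algebraMap K (AlgebraicClosure K) E₂.a₆)
    (h12 : ζ ^ 12 = 1) :
    ∃ (A : E₂.geomPoints ≃+ E₂.geomPoints) (T : AddMonoid.End E₂.geomPoints),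
      (∀ Q, T Q = A Q) ∧ IsAlgebraicOn E₂ E₂ A ∧
      (∀ (x y : AlgebraicClosure K)
        (h : (E₂.baseChange (AlgebraicClosure K)).toAffine.Nonsingular x y),
        ∃ h', A (Affine.Point.some x y h) = Affine.Point.some (ζ ^ 2 * x) (ζ ^ 3 * y) h') ∧
      T ^ 12 = 1 := by
  set D : VariableChange (AlgebraicClosure K) := ⟨(Units.mk0 ζ hζ)⁻¹, 0, 0, 0⟩ with hD
  have hDV : D • E₂.baseChange (AlgebraicClosure K) = E₂.baseChange (AlgebraicClosure K) :=
    scaling_smul_eq_self _ (by simp [h1]) (by simp [h2]) (by simp [h3]) hζ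
      (by simpa using h4) (by simpa using h6)
  set A : E₂.geomPoints ≃+ E₂.geomPoints :=
    (VariableChange.pointEquiv (E₂.baseChange (AlgebraicClosure K)) D).trans
      (Affine.Point.congrEquiv hDV) with hA
  have hDX : ∀ x : AlgebraicClosure K, D.toX x = ζ ^ 2 * x := fun x ↦ by
    simp [VariableChange.toX_def, hD]
  have hDY : ∀ x y : AlgebraicClosure K, D.toY x y = ζ ^ 3 * y := fun x y ↦ by
    simp [VariableChange.toY_def, hD]
  have hA_some : ∀ (x y : AlgebraicClosure K)
      (h : (E₂.baseChange (AlgebraicClosure K)).toAffine.Nonsingular x y),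
      ∃ h', A (Affine.Point.some x y h) = Affine.Point.some (ζ ^ 2 * x) (ζ ^ 3 * y) h' := by
    intro x y h
    refine ⟨?_, ?_⟩
    · have := hDV ▸ (VariableChange.nonsingular_iff _ D x y).mpr h
      rwa [hDX, hDY] at this
    · change Affine.Point.congrEquiv hDV
          (VariableChange.pointEquiv (E₂.baseChange (AlgebraicClosure K)) D (Affine.Point.some x y h)) = _
      rw [VariableChange.pointEquiv_some, Affine.Point.congrEquiv_some]
      simp only [hDX, hDY]
  obtain ⟨T, hT⟩ : ∃ T : AddMonoid.End E₂.geomPoints, ∀ Q, T Q = A Q := ⟨A.toAddMonoidHom, fun Q ↦ rfl⟩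
  refine ⟨A, T, hT, isAlgebraicOn_pointEquiv_trans_congrEquiv D hDV, hA_some, ?_⟩
  -- `T¹² = 1`: on affine points `T^n (x, y) = (ζ^{2n} x, ζ^{3n} y)`
  have hpow : ∀ (n : ℕ) (x y : AlgebraicClosure K)
      (h : (E₂.baseChange (AlgebraicClosure K)).toAffine.Nonsingular x y),
      ∃ h', (T ^ n) (Affine.Point.some x y h) =
        Affine.Point.some (ζ ^ (2 * n) * x) (ζ ^ (3 * n) * y) h' := by
    intro n
    induction n with
    | zero =>
      intro x y h
      refine ⟨by simpa using h, ?_⟩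
      simp
    | succ n ih =>
      intro x y h
      obtain ⟨h₁, hA₁⟩ := hA_some x y h
      obtain ⟨h₂, hA₂⟩ := ih (ζ ^ 2 * x) (ζ ^ 3 * y) h₁
      have e2 : ζ ^ (2 * (n + 1)) * x = ζ ^ (2 * n) * (ζ ^ 2 * x) := by ring
      have e3 : ζ ^ (3 * (n + 1)) * y = ζ ^ (3 * n) * (ζ ^ 3 * y) := by ring
      refine ⟨by rw [e2, e3]; exact h₂, ?_⟩
      rw [pow_succ, AddMonoid.End.coe_mul, Function.comp_apply, hT, hA₁, hA₂]
      simp only [e2, e3]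
  refine DFunLike.ext _ _ fun P ↦ ?_
  rcases P with _ | ⟨x, y, h⟩
  · change (T ^ 12) (0 : E₂.geomPoints) = (1 : AddMonoid.End E₂.geomPoints) (0 : E₂.geomPoints)
    rw [map_zero, map_zero]
  · obtain ⟨h', hP⟩ := hpow 12 x y h
    refine hP.trans ?_
    have e2 : ζ ^ (2 * 12) * x = x := by
      rw [show ζ ^ (2 * 12) = (ζ ^ 12) ^ 2 by ring, h12, one_pow, one_mul]
    have e3 : ζ ^ (3 * 12) * y = y := by
      rw [show ζ ^ (3 * 12) = (ζ ^ 12) ^ 3 by ring, h12, one_pow, one_mul]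
    simp only [e2, e3, AddMonoid.End.coe_one, id_eq]

/-! ### The isomorphism and its cocycle -/

/-- **Same `j` ⟹ `K̄`-isomorphic, with a Galois cocycle of exponent `12`** (Silverman, *AEC*,
Prop. III.1.4(b), X.5.4 and Cor. III.10.2).  For elliptic curves `E, E'` over a field `K` of
characteristic `0` with `j(E) = j(E')` there is an additive isomorphism `ι : E(K̄) ≃+ E'(K̄)`,
algebraic in both directions, such that for every `σ ∈ Γ_K` there is an algebraic additive
endomorphism `c` of `E'(K̄)` — an automorphism of `E'`, the value at `σ` of the cocycle
`σ ↦ ι ∘ (ι^σ)⁻¹` — with `c¹² = 1` and `ι(σ • P) = c(σ • ι P)` for all `P ∈ E(K̄)`.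
[cite: SilvermanAEC2009, Prop. III.1.4(b), Prop. X.5.4 and Cor. III.10.2] -/
theorem exists_addEquiv_geomPoints_cocycle_of_j_eq [CharZero K] (E E' : WeierstrassCurve K)
    [E.IsElliptic] [E'.IsElliptic] (hj : E.j = E'.j) :
    ∃ ι : E.geomPoints ≃+ E'.geomPoints, IsAlgebraicOn E E' ι ∧ IsAlgebraicOn E' E ι.symm ∧
      ∀ σ : Field.absoluteGaloisGroup K, ∃ c : AddMonoid.End E'.geomPoints,
        IsAlgebraicOn E' E' c ∧ c ^ 12 = 1 ∧ ∀ P : E.geomPoints, ι (σ • P) = c (σ • ι P) := by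
  letI : Invertible (2 : K) := invertibleOfNonzero two_ne_zero
  letI : Invertible (3 : K) := invertibleOfNonzero (by norm_num)
  obtain ⟨C₁, hC₁⟩ := E.exists_variableChange_isShortNF
  obtain ⟨C₂, hC₂⟩ := E'.exists_variableChange_isShortNF
  have hj₁ : (C₁ • E).j = (C₂ • E').j := by rw [variableChange_j, variableChange_j, hj]
  obtain ⟨u, hu0, hu4, hu6, w, hu12⟩ := exists_twisting_parameter hj₁
  -- the scaling `D = ⟨u, 0, 0, 0⟩` carries `((C₁ • E))_L` to `((C₂ • E'))_L`
  set D : VariableChange (AlgebraicClosure K) := ⟨Units.mk0 u hu0, 0, 0, 0⟩ with hD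
  have hDE : D • (C₁ • E).baseChange (AlgebraicClosure K) = (C₂ • E').baseChange (AlgebraicClosure K) := by
    ext
    · simp [variableChange_a₁, hD]
    · simp [variableChange_a₂, a₂_of_isShortNF, hD]
    · simp [variableChange_a₃, hD]
    · simp only [variableChange_a₄, hD, Units.val_inv_eq_inv_val, Units.val_mk0, mul_zero, sub_zero,
        add_zero, zero_mul]
      rw [show ((C₁ • E).baseChange (AlgebraicClosure K)).a₄ = algebraMap K (AlgebraicClosure K) (C₁ • E).a₄ from rfl,
        show ((C₂ • E').baseChange (AlgebraicClosure K)).a₄ = algebraMap K (AlgebraicClosure K) (C₂ • E').a₄ from rfl,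
        ← hu4]
      field_simp
      simp
    · simp only [variableChange_a₆, hD, Units.val_inv_eq_inv_val, Units.val_mk0, mul_zero, sub_zero,
        add_zero, zero_mul]
      rw [show ((C₁ • E).baseChange (AlgebraicClosure K)).a₆ = algebraMap K (AlgebraicClosure K) (C₁ • E).a₆ from rfl,
        show ((C₂ • E').baseChange (AlgebraicClosure K)).a₆ = algebraMap K (AlgebraicClosure K) (C₂ • E').a₆ from rfl,
        ← hu6]
      field_simp
      simp
  -- the three pieces of `ι`
  set e₁ : E.geomPoints ≃+ (C₁ • E).geomPoints :=
    VariableChange.pointEquivBaseChange E C₁ (AlgebraicClosure K) with he₁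
  set e₂ : (C₁ • E).geomPoints ≃+ (C₂ • E').geomPoints :=
    (VariableChange.pointEquiv ((C₁ • E).baseChange (AlgebraicClosure K)) D).trans
      (Affine.Point.congrEquiv hDE) with he₂
  set e₄ : E'.geomPoints ≃+ (C₂ • E').geomPoints :=
    VariableChange.pointEquivBaseChange E' C₂ (AlgebraicClosure K) with he₄
  have halg₁ : IsAlgebraicOn E (C₁ • E) e₁ :=
    isAlgebraicOn_pointEquiv_trans_congrEquiv (C₁.map (algebraMap K (AlgebraicClosure K)))
      (VariableChange.baseChange_smul_eq E C₁ (AlgebraicClosure K)).symm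
  have halg₁' : IsAlgebraicOn (C₁ • E) E e₁.symm :=
    isAlgebraicOn_pointEquiv_trans_congrEquiv_symm (C₁.map (algebraMap K (AlgebraicClosure K)))
      (VariableChange.baseChange_smul_eq E C₁ (AlgebraicClosure K)).symm
  have halg₂ : IsAlgebraicOn (C₁ • E) (C₂ • E') e₂ := isAlgebraicOn_pointEquiv_trans_congrEquiv D hDE
  have halg₂' : IsAlgebraicOn (C₂ • E') (C₁ • E) e₂.symm := isAlgebraicOn_pointEquiv_trans_congrEquiv_symm D hDE
  have halg₄ : IsAlgebraicOn E' (C₂ • E') e₄ :=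
    isAlgebraicOn_pointEquiv_trans_congrEquiv (C₂.map (algebraMap K (AlgebraicClosure K)))
      (VariableChange.baseChange_smul_eq E' C₂ (AlgebraicClosure K)).symm
  have halg₄' : IsAlgebraicOn (C₂ • E') E' e₄.symm :=
    isAlgebraicOn_pointEquiv_trans_congrEquiv_symm (C₂.map (algebraMap K (AlgebraicClosure K)))
      (VariableChange.baseChange_smul_eq E' C₂ (AlgebraicClosure K)).symm
  set ι : E.geomPoints ≃+ E'.geomPoints := e₁.trans (e₂.trans e₄.symm) with hι
  have hιapply : ∀ P, ι P = e₄.symm (e₂ (e₁ P)) := fun P ↦ rfl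
  refine ⟨ι, ?_, ?_, fun σ ↦ ?_⟩
  · -- `ι` is algebraic
    have h12 : IsAlgebraicOn E (C₂ • E') (fun P ↦ e₂.toAddMonoidHom (e₁.toAddMonoidHom P)) :=
      IsAlgebraicOn.comp (W := E) (W' := (C₁ • E)) (W'' := (C₂ • E')) (f := e₂.toAddMonoidHom)
        (g := e₁.toAddMonoidHom) halg₂ halg₁
    exact IsAlgebraicOn.comp (W := E) (W' := (C₂ • E')) (W'' := E') (f := e₄.symm.toAddMonoidHom)
      (g := e₂.toAddMonoidHom.comp e₁.toAddMonoidHom) halg₄' h12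
  · -- `ι⁻¹` is algebraic
    have h42 : IsAlgebraicOn E' (C₁ • E) (fun Q ↦ e₂.symm.toAddMonoidHom (e₄.toAddMonoidHom Q)) :=
      IsAlgebraicOn.comp (W := E') (W' := (C₂ • E')) (W'' := (C₁ • E)) (f := e₂.symm.toAddMonoidHom)
        (g := e₄.toAddMonoidHom) halg₂' halg₄
    exact IsAlgebraicOn.comp (W := E') (W' := (C₁ • E)) (W'' := E) (f := e₁.symm.toAddMonoidHom)
      (g := e₂.symm.toAddMonoidHom.comp e₄.toAddMonoidHom) halg₁' h42
  · -- the cocycle at `σ`: scaling by `ζ = σ(u)/u`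
    set σ' : AlgebraicClosure K →ₐ[K] AlgebraicClosure K :=
      AlgEquiv.toAlgHom (R := K) (A₁ := AlgebraicClosure K) (A₂ := AlgebraicClosure K) σ with hσ'
    have hσu0 : σ' u ≠ 0 := (map_ne_zero σ').mpr hu0
    set ζ : (AlgebraicClosure K) := σ' u * u⁻¹ with hζ
    have hζ0 : ζ ≠ 0 := mul_ne_zero hσu0 (inv_ne_zero hu0)
    -- `σ(u)^4 A' = A`, `σ(u)^6 B' = B`, `σ(u)^12 = u^12`
    have hσ4 : σ' u ^ 4 * algebraMap K (AlgebraicClosure K) (C₂ • E').a₄ =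
        algebraMap K (AlgebraicClosure K) (C₁ • E).a₄ := by
      have := congrArg σ' hu4
      rwa [map_mul, map_pow, AlgHom.commutes, AlgHom.commutes] at this
    have hσ6 : σ' u ^ 6 * algebraMap K (AlgebraicClosure K) (C₂ • E').a₆ =
        algebraMap K (AlgebraicClosure K) (C₁ • E).a₆ := by
      have := congrArg σ' hu6
      rwa [map_mul, map_pow, AlgHom.commutes, AlgHom.commutes] at this
    have hσ12 : σ' u ^ 12 = u ^ 12 := by
      have := congrArg σ' hu12
      rwa [map_pow, AlgHom.commutes, ← hu12] at this
    have hζ4 : ζ ^ 4 * algebraMap K (AlgebraicClosure K) (C₂ • E').a₄ =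
        algebraMap K (AlgebraicClosure K) (C₂ • E').a₄ := by
      calc ζ ^ 4 * algebraMap K (AlgebraicClosure K) (C₂ • E').a₄
          = (u⁻¹) ^ 4 * (σ' u ^ 4 * algebraMap K (AlgebraicClosure K) (C₂ • E').a₄) := by rw [hζ]; ring
        _ = (u⁻¹) ^ 4 * (u ^ 4 * algebraMap K (AlgebraicClosure K) (C₂ • E').a₄) := by rw [hσ4, hu4]
        _ = algebraMap K (AlgebraicClosure K) (C₂ • E').a₄ := by field_simp
    have hζ6 : ζ ^ 6 * algebraMap K (AlgebraicClosure K) (C₂ • E').a₆ =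
        algebraMap K (AlgebraicClosure K) (C₂ • E').a₆ := by
      calc ζ ^ 6 * algebraMap K (AlgebraicClosure K) (C₂ • E').a₆
          = (u⁻¹) ^ 6 * (σ' u ^ 6 * algebraMap K (AlgebraicClosure K) (C₂ • E').a₆) := by rw [hζ]; ring
        _ = (u⁻¹) ^ 6 * (u ^ 6 * algebraMap K (AlgebraicClosure K) (C₂ • E').a₆) := by rw [hσ6, hu6]
        _ = algebraMap K (AlgebraicClosure K) (C₂ • E').a₆ := by field_simp
    have hζ12 : ζ ^ 12 = 1 := by
      rw [hζ, mul_pow, hσ12, inv_pow, mul_inv_cancel₀ (pow_ne_zero 12 hu0)]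
    obtain ⟨A, T, hT, hAalg, hA_some, hT12⟩ := exists_scaling_geomPoints (C₂ • E') (a₁_of_isShortNF (W := (C₂ • E')))
      (a₂_of_isShortNF (W := (C₂ • E'))) (a₃_of_isShortNF (W := (C₂ • E'))) hζ0 hζ4 hζ6 hζ12
    have hTalg : IsAlgebraicOn (C₂ • E') (C₂ • E') T := by
      have hfun : (⇑T : (C₂ • E').geomPoints → (C₂ • E').geomPoints) = ⇑A := funext hT
      rw [hfun]
      exact hAalg
    -- the cocycle `c = e₄⁻¹ ∘ A ∘ e₄`
    obtain ⟨c, hc⟩ : ∃ c : AddMonoid.End E'.geomPoints, ∀ Q, c Q = e₄.symm (T (e₄ Q)) :=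
      ⟨e₄.symm.toAddMonoidHom.comp (T.comp e₄.toAddMonoidHom), fun Q ↦ rfl⟩
    refine ⟨c, ?_, ?_, fun P ↦ ?_⟩
    · -- algebraic
      have h1 : IsAlgebraicOn E' (C₂ • E') (fun Q ↦ T (e₄.toAddMonoidHom Q)) :=
        IsAlgebraicOn.comp (W := E') (W' := (C₂ • E')) (W'' := (C₂ • E')) (f := T) (g := e₄.toAddMonoidHom) hTalg halg₄
      have h2 := IsAlgebraicOn.comp (W := E') (W' := (C₂ • E')) (W'' := E') (f := e₄.symm.toAddMonoidHom)
        (g := T.comp e₄.toAddMonoidHom) halg₄' h1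
      have hfun : (⇑c : E'.geomPoints → E'.geomPoints) =
          fun Q ↦ e₄.symm.toAddMonoidHom ((T.comp e₄.toAddMonoidHom) Q) := funext hc
      rw [hfun]
      exact h2
    · -- `c¹² = 1`
      have hcpow : ∀ (n : ℕ) (Q : E'.geomPoints), (c ^ n) Q = e₄.symm ((T ^ n) (e₄ Q)) := by
        intro n
        induction n with
        | zero => intro Q; simp
        | succ n ih =>
          intro Q
          rw [pow_succ, AddMonoid.End.coe_mul, Function.comp_apply, hc, ih, AddEquiv.apply_symm_apply,
            pow_succ, AddMonoid.End.coe_mul, Function.comp_apply]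
      refine DFunLike.ext _ _ fun Q ↦ ?_
      rw [hcpow, hT12, AddMonoid.End.one_apply, AddMonoid.End.one_apply, AddEquiv.symm_apply_apply]
    · -- `ι(σ • P) = c (σ • ι P)`
      -- Galois behaviour of the pieces
      have he₁σ : e₁ (σ • P) = σ • e₁ P := by
        change e₁ (Affine.Point.map σ' P) = Affine.Point.map σ' (e₁ P)
        exact VariableChange.pointEquivBaseChange_map_algEquiv E C₁ σ P
      have he₄σ : ∀ R : (C₂ • E').geomPoints, e₄.symm (σ • R) = σ • e₄.symm R := fun R ↦ by
        change e₄.symm (Affine.Point.map σ' R) = Affine.Point.map σ' (e₄.symm R)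
        exact (VariableChange.pointEquivBaseChange_symm_map E' C₂ σ' R).symm
      have hDX : ∀ x : (AlgebraicClosure K), D.toX x = (u⁻¹) ^ 2 * x := fun x ↦ by
        simp [VariableChange.toX_def, hD]
      have hDY : ∀ x y : (AlgebraicClosure K), D.toY x y = (u⁻¹) ^ 3 * y := fun x y ↦ by
        simp [VariableChange.toY_def, hD]
      have he₂_some : ∀ (x y : AlgebraicClosure K)
          (h : ((C₁ • E).baseChange (AlgebraicClosure K)).toAffine.Nonsingular x y),
          ∃ h', e₂ (Affine.Point.some x y h) =
            Affine.Point.some ((u⁻¹) ^ 2 * x) ((u⁻¹) ^ 3 * y) h' := fun x y h ↦ by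
        refine ⟨?_, ?_⟩
        · have := hDE ▸ (VariableChange.nonsingular_iff _ D x y).mpr h
          rwa [hDX, hDY] at this
        · change Affine.Point.congrEquiv hDE
              (VariableChange.pointEquiv ((C₁ • E).baseChange (AlgebraicClosure K)) D (Affine.Point.some x y h)) = _
          rw [VariableChange.pointEquiv_some, Affine.Point.congrEquiv_some]
          simp only [hDX, hDY]
      -- the Galois action on affine points of `(C₁ • E)(K̄)`, `(C₂ • E')(K̄)` is coordinatewise
      have hsmul₁ : ∀ (x y : AlgebraicClosure K)
          (h : ((C₁ • E).baseChange (AlgebraicClosure K)).toAffine.Nonsingular x y), ∃ h',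
          @HSMul.hSMul (Field.absoluteGaloisGroup K) (C₁ • E).geomPoints (C₁ • E).geomPoints _ σ
            (Affine.Point.some x y h) = Affine.Point.some (σ' x) (σ' y) h' :=
        fun x y h ↦ ⟨_, Affine.Point.map_some σ' h⟩
      have hsmul₂ : ∀ (x y : AlgebraicClosure K)
          (h : ((C₂ • E').baseChange (AlgebraicClosure K)).toAffine.Nonsingular x y), ∃ h',
          @HSMul.hSMul (Field.absoluteGaloisGroup K) (C₂ • E').geomPoints (C₂ • E').geomPoints _ σ
            (Affine.Point.some x y h) = Affine.Point.some (σ' x) (σ' y) h' :=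
        fun x y h ↦ ⟨_, Affine.Point.map_some σ' h⟩
      have he₂σ : ∀ Q : (C₁ • E).geomPoints, e₂ (σ • Q) = A (σ • e₂ Q) := by
        intro Q
        rcases Q with _ | ⟨x, y, h⟩
        · change e₂ (σ • (0 : (C₁ • E).geomPoints)) = A (σ • e₂ (0 : (C₁ • E).geomPoints))
          rw [smul_zero, map_zero, smul_zero, map_zero]
        · obtain ⟨hσ', hmapσ⟩ := hsmul₁ x y h
          obtain ⟨h₂, he₂P⟩ := he₂_some x y h
          obtain ⟨h₂σ, he₂σP⟩ := he₂_some (σ' x) (σ' y) hσ'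
          obtain ⟨h₃, hmap₃⟩ := hsmul₂ ((u⁻¹) ^ 2 * x) ((u⁻¹) ^ 3 * y) h₂
          obtain ⟨h₄, hA₄⟩ := hA_some (σ' ((u⁻¹) ^ 2 * x)) (σ' ((u⁻¹) ^ 3 * y)) h₃
          rw [hmapσ, he₂σP, he₂P, hmap₃, hA₄]
          have hσinv : σ' u⁻¹ = (σ' u)⁻¹ := map_inv₀ σ' u
          have hX : (u⁻¹) ^ 2 * σ' x = ζ ^ 2 * σ' ((u⁻¹) ^ 2 * x) := by
            rw [map_mul, map_pow, hσinv, hζ]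
            field_simp
          have hY : (u⁻¹) ^ 3 * σ' y = ζ ^ 3 * σ' ((u⁻¹) ^ 3 * y) := by
            rw [map_mul, map_pow, hσinv, hζ]
            field_simp
          simp only [hX, hY]
      rw [hιapply, hιapply, he₁σ, he₂σ, hc, hT, ← he₄σ, AddEquiv.apply_symm_apply]

end Literature.NumberTheory.EllipticCurves

end
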